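import Summits.BirchSwinnertonDyer.BirchSwinnertonDyer.Theorems.AlignedTransportAtTwoBSDOfMainConjectureRankOneAtTwoDisegniTight
import Summits.BirchSwinnertonDyer.BirchSwinnertonDyer.Theorems.AlignedTransportAtTwoBSDOfMainConjectureRankOneAtTwoSigmaSqTwoExistence
import Summits.BirchSwinnertonDyer.BirchSwinnertonDyer.Theorems.AlignedTransportAtTwoBSDOfMainConjectureRankOneAtTwoLeadingTermViaTwoAdicBSD
import Summits.BirchSwinnertonDyer.Rank1Residual.F1Sign2.SchneiderLeadingTermFormulaAtTwoSq
import HarnessLib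

/-!
# Route `AlignedTransportAtTwo`, crux C3′ `BSDOfMainConjectureRankOneAtTwo` (stmt-BirchSwinnertonDyer-23008), line `birth` v6 —
# the Mazur–Tate `Σ²` binder `hMT` DISCHARGED in every C3′ closure, and the crux-level by-name equivalence
# «C3′ ⟺ the Schneider leading-term formula at `2` on the cell under `MC(W,2)`» modulo THREE published facts

Cell `bsd-f1-sign2`, WIDTH-5 attach seat `bsd-line-att-p3` g10 (lineage att-p3; g9 landed
`…Theorems.AlignedTransportAtTwoSigmaSqTwo.mazurTate_sigmaSq_existsUnique_two_holds`, p644698: the PRINT named fact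
`Literature.NumberTheory.EllipticCurves.mazurTate_sigmaSq_existsUnique_two` — Mazur–Tate 1991 Thm. 3.1 at `p = 2` / Silverman 2005 §5 Rem. 2 — is a
THEOREM of the tree). THEOREMS ONLY; nothing asserted; `--supports stmt-BirchSwinnertonDyer-23008`. BSD is NOT proved; C3′ is NOT closed.

What this file does (glue named by the g9 landing; no new mathematics):
* §1 `exists_isCanonicalSq_two_holds` / `existsUnique_isCanonicalSq_two_holds` — **binder-free**: for every globally minimal `W/ℚ` with good
  ORDINARY reduction at `2`, THE canonical `Σ²` `2`-adic height datum `Dh : PAdicHeightData W 2` with `Dh.IsCanonicalSq` EXISTS and is UNIQUE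
  (the Literature theorems `exists_isCanonicalSq_two` / `existsUnique_isCanonicalSq_two` with their `hMT` premise supplied by the g9 theorem).
* §2 the per-curve TIGHTNESS of line `birth` without `hMT`, in the BY-NAME currency of the registered open stub
  (`F1Sign2.SchneiderLeadingTermFormulaAtTwoSqAt W`): on a C3′ cell curve (`IsOrdinaryAt W 2`, `r_an = 1`, simple zero of `L₂(f_E)`, `MC(W,2)`),
  modulo Disegni 2020 Thm. 1, GZK and modularity ONLY, `SchneiderLeadingTermFormulaAtTwoSqAt W ↔ BSDp W 2`
  (`schneiderLeadingTermFormulaAtTwoSqAt_iff_bsdp`; from `…DisegniTight.leadingTermFormulaAtTwoAt_iff_bsdp`, p611969).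
* §3 the crux closures without `hMT`: `bsdOfMainConjectureRankOneAtTwo_of_formula_of_disegni` (C3′ ⟸ the registered open stub BY NAME +
  Disegni + GZK + modularity = the composition of skeleton v6), `…_of_schneiderAtTwoSq_of_disegni` (T-23008-a by name), the v2 closure through
  `PerrinRiouComparisonAtTwo`, and the `lfunction`-route closure (`…LeadingTermViaTwoAdicBSD`, K2-Gv + K2-G′v + GZK + modularity + period unit).
* §4 **the reduction is lossless AT CRUX LEVEL, by name**: `bsdOfMainConjectureRankOneAtTwo_iff_formulaOnCell` — modulo {Disegni, GZK, modularity},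
  `BSDOfMainConjectureRankOneAtTwo ↔ (∀ cell curve W, MC(W,2) → SchneiderLeadingTermFormulaAtTwoSqAt W)` (same seven binders as the crux); and the
  sufficient direction from the four analytic binders alone (`…_of_formulaOnOrdinaryRankOne`: ¬CM, no rational `2`-torsion, `Δ ∉ ℚ²` idle).
So after v6 the crux C3′ reads: THREE published facts (modularity, GZK, Disegni 2020 Thm. 1) + ONE statement not in print at `2`
(`F1Sign2.SchneiderLeadingTermFormulaAtTwoSq`, equivalently its restriction to the cell under `MC`), all by name; the `Σ²` receptacle is inhabited
unconditionally. Consumers outside this route that still carry `(hMT : mazurTate_sigmaSq_existsUnique_two)` (gk2 `…MinimalTwinBSDTwo{TwoAdic,Disegni}`,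
stmt-22985; bsd-goldfeld 19141 height files) discharge it the same way (`mazurTate_sigmaSq_existsUnique_two_holds`).

References: [MazurTate1991] Thm. 3.1; [Silverman2005DivPoly] §5 Rem. 2; [Disegni2020] Thm. 1 = Thm. 4 (i); [BalakrishnanMullerStein2015] Thm. 1.7 (3);
[Schneider1985] Thm. 2′; [GrossZagier1986]; [Kolyvagin1990]; [Miller2011LMS] Def. 1.1.
-/

set_option autoImplicit false
-- the route's Theorems namespace repeats a component by design (summit = sub-problem, D-0017).
set_option linter.dupNamespace false

noncomputable section

open scoped Classical MatrixGroups ModularForm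

open CongruenceSubgroup WeierstrassCurve Literature.NumberTheory.EllipticCurves
  Literature.NumberTheory.EllipticCurves.ModularForms Literature.NumberTheory.EllipticCurves.Greenberg1999
  Summit.BirchSwinnertonDyer.Rank1Residual.F1Sign2
  Summit.BirchSwinnertonDyer.BirchSwinnertonDyer.Theorems.Rank1ResidualX1Defs
  Summit.BirchSwinnertonDyer.BirchSwinnertonDyer.Theses.AlignedTransportAtTwo
  Summit.BirchSwinnertonDyer.BirchSwinnertonDyer.Theorems.AlignedTransportAtTwoSigmaSqTwo

namespace Summit.BirchSwinnertonDyer.BirchSwinnertonDyer.Theorems.AlignedTransportAtTwoSigmaSqTwoDischarge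

/-! ## §1 THE canonical `Σ²` `2`-adic height datum exists and is unique — binder-free -/

/-- **The `Σ²` receptacle at a good ordinary `2` is inhabited, unconditionally**: for `W/ℚ` globally minimal with good reduction at `2` and
`2 ∤ a₂`, there is a `2`-adic height datum `Dh : PAdicHeightData W 2` with `Dh.IsCanonicalSq` (Literature `exists_isCanonicalSq_two` with its
Mazur–Tate premise discharged by `mazurTate_sigmaSq_existsUnique_two_holds`, att-p3 g9 p644698). [cite: MazurTate1991, Thm. 3.1]
[cite: Silverman2005DivPoly, §5 Rem. 2] [cite: MazurSteinTate2006, §2.7] -/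
theorem exists_isCanonicalSq_two_holds (W : WeierstrassCurve ℚ) [W.IsElliptic] [W.IsGloballyMinimal]
    (hgood : W.HasGoodReductionAtPrime 2) (hord : ¬ (2 : ℤ) ∣ W.frobeniusTrace 2) :
    ∃ D : PAdicHeightData W 2, D.IsCanonicalSq :=
  exists_isCanonicalSq_two mazurTate_sigmaSq_existsUnique_two_holds W hgood hord

/-- **… and it is unique, unconditionally** (Literature `existsUnique_isCanonicalSq_two`, premise discharged). [cite: MazurSteinTate2006, §2.7]
[cite: Silverman2005DivPoly, §5 Rem. 2] -/
theorem existsUnique_isCanonicalSq_two_holds (W : WeierstrassCurve ℚ) [W.IsElliptic] [W.IsGloballyMinimal]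
    (hgood : W.HasGoodReductionAtPrime 2) (hord : ¬ (2 : ℤ) ∣ W.frobeniusTrace 2) :
    ∃! D : PAdicHeightData W 2, D.IsCanonicalSq :=
  existsUnique_isCanonicalSq_two mazurTate_sigmaSq_existsUnique_two_holds W hgood hord

/-- The same under the tree's `IsOrdinaryAt W 2` (`= good reduction at 2 ∧ 2 ∤ a₂`). [cite: MazurTate1991, Thm. 3.1] -/
theorem exists_isCanonicalSq_two_of_isOrdinaryAt (W : WeierstrassCurve ℚ) [W.IsElliptic] [W.IsGloballyMinimal]
    (hord : IsOrdinaryAt W 2) : ∃ D : PAdicHeightData W 2, D.IsCanonicalSq :=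
  exists_isCanonicalSq_two_holds W hord.1 hord.2

/-- Uniqueness under `IsOrdinaryAt W 2`. [cite: MazurSteinTate2006, §2.7] -/
theorem existsUnique_isCanonicalSq_two_of_isOrdinaryAt (W : WeierstrassCurve ℚ) [W.IsElliptic] [W.IsGloballyMinimal]
    (hord : IsOrdinaryAt W 2) : ∃! D : PAdicHeightData W 2, D.IsCanonicalSq :=
  existsUnique_isCanonicalSq_two_holds W hord.1 hord.2

/-! ## §2 Per curve: the registered open stub BY NAME is equivalent to `BSD(W,2)` on the cell, modulo three published facts -/

/-- **Per-curve closure, hMT-free, by name (CONDITIONAL on Disegni/GZK/modularity; closes nothing).** On a C3′ cell curve `W` (good ordinary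
at `2`, analytic rank one, simple zero of `L₂(f_E)` at `T = 0` for every conductor-level newform, `MazurMainConjecture W 2`): the registered open
stub read at `W`, `F1Sign2.SchneiderLeadingTermFormulaAtTwoSqAt W`, gives `BSDp W 2`. [cite: Disegni2020, Thm. 1]
[cite: BalakrishnanMullerStein2015, Thm. 1.7 (3)] [cite: Miller2011LMS, Def. 1.1] -/
theorem bsdp_of_schneiderLeadingTermFormulaAtTwoSqAt (hD : Disegni2020.padicBSD_goodOrd_rankOne)
    (hGZK : rank_eq_analyticRank_of_analyticRank_le_one) (hmod : nonempty_modularParametrizationData)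
    (W : WeierstrassCurve ℚ) [W.IsElliptic] [W.IsGloballyMinimal] (hord : IsOrdinaryAt W 2) (hr : W.analyticRank = 1)
    (hL : ∀ [NeZero (W.conductorNorm ℤ)] (f : CuspForm (Gamma0 (W.conductorNorm ℤ)) 2), IsNewformOf W f →
      (padicLFunction f (unitRoot W 2 : ℚ_[2])).order = 1)
    (hMC : MazurMainConjecture W 2) (h : SchneiderLeadingTermFormulaAtTwoSqAt W) : BSDp W 2 :=
  AlignedTransportAtTwoDisegniTight.bsdp_of_leadingTermFormulaAtTwoAt_of_disegni hD hGZK hmod mazurTate_sigmaSq_existsUnique_two_holds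
    W hord hr hL hMC (h hord.1 hord.2)

/-- **The converse per curve, by name (CONDITIONAL on Disegni/GZK/modularity; closes nothing):** on a cell curve, `BSDp W 2` gives the open stub
read at `W` (`…DisegniTight.leadingTermFormulaAtTwoAt_of_bsdp`, which never used `hMT`). [cite: Disegni2020, Thm. 1] [cite: Miller2011LMS, Def. 1.1] -/
theorem schneiderLeadingTermFormulaAtTwoSqAt_of_bsdp (hD : Disegni2020.padicBSD_goodOrd_rankOne)
    (hGZK : rank_eq_analyticRank_of_analyticRank_le_one) (hmod : nonempty_modularParametrizationData)
    (W : WeierstrassCurve ℚ) [W.IsElliptic] [W.IsGloballyMinimal] (hord : IsOrdinaryAt W 2) (hr : W.analyticRank = 1)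
    (hL : ∀ [NeZero (W.conductorNorm ℤ)] (f : CuspForm (Gamma0 (W.conductorNorm ℤ)) 2), IsNewformOf W f →
      (padicLFunction f (unitRoot W 2 : ℚ_[2])).order = 1)
    (hMC : MazurMainConjecture W 2) (h : BSDp W 2) : SchneiderLeadingTermFormulaAtTwoSqAt W :=
  fun _ _ κ γ hκ hγ hγ' D _ hX fE hchar Dh hDh _ _ =>
    AlignedTransportAtTwoDisegniTight.leadingTermFormulaAtTwoAt_of_bsdp hD hGZK hmod W hord hr hL hMC h κ γ hκ hγ hγ' D hX fE hchar Dh hDh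

/-- **TIGHTNESS per curve, hMT-free, by name (CONDITIONAL on Disegni/GZK/modularity; closes nothing):** on a C3′ cell curve,
`F1Sign2.SchneiderLeadingTermFormulaAtTwoSqAt W ↔ BSDp W 2`. [cite: Disegni2020, Thm. 1] [cite: BalakrishnanMullerStein2015, Thm. 1.7 (3)] -/
theorem schneiderLeadingTermFormulaAtTwoSqAt_iff_bsdp (hD : Disegni2020.padicBSD_goodOrd_rankOne)
    (hGZK : rank_eq_analyticRank_of_analyticRank_le_one) (hmod : nonempty_modularParametrizationData)
    (W : WeierstrassCurve ℚ) [W.IsElliptic] [W.IsGloballyMinimal] (hord : IsOrdinaryAt W 2) (hr : W.analyticRank = 1)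
    (hL : ∀ [NeZero (W.conductorNorm ℤ)] (f : CuspForm (Gamma0 (W.conductorNorm ℤ)) 2), IsNewformOf W f →
      (padicLFunction f (unitRoot W 2 : ℚ_[2])).order = 1)
    (hMC : MazurMainConjecture W 2) : SchneiderLeadingTermFormulaAtTwoSqAt W ↔ BSDp W 2 :=
  ⟨bsdp_of_schneiderLeadingTermFormulaAtTwoSqAt hD hGZK hmod W hord hr hL hMC,
   schneiderLeadingTermFormulaAtTwoSqAt_of_bsdp hD hGZK hmod W hord hr hL hMC⟩

/-! ## §3 The crux closures without the `Σ²` binder -/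

/-- **C3′ from the registered open stub BY NAME + THREE published facts (CONDITIONAL; closes nothing):** `F1Sign2.SchneiderLeadingTermFormulaAtTwoSq`
(OPEN at `2`) + Disegni 2020 Thm. 1 + Gross–Zagier–Kolyvagin + modularity ⇒ `BSDOfMainConjectureRankOneAtTwo`. This is §3 of `…AlignedTransportAtTwoDisegni`
(p609883) with `hMT` discharged — the composition of skeleton `Lines/birth.lean` v6 (stubs: M, GZK, Disegni PRINT; `stub_sigmaSqTwo` CLOSED by name;
`stub_leadingTermFormulaAtTwo` OPEN). BSD is not proved. [cite: BalakrishnanMullerStein2015, Thm. 1.7 (3)] [cite: Schneider1985, Thm. 2′] [cite: Disegni2020, Thm. 1] -/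
theorem bsdOfMainConjectureRankOneAtTwo_of_formula_of_disegni (h : SchneiderLeadingTermFormulaAtTwoSq)
    (hD : Disegni2020.padicBSD_goodOrd_rankOne) (hGZK : rank_eq_analyticRank_of_analyticRank_le_one)
    (hmod : nonempty_modularParametrizationData) : BSDOfMainConjectureRankOneAtTwo :=
  AlignedTransportAtTwoDisegni.bsdOfMainConjectureRankOneAtTwo_of_leadingTermFormulaAtTwo_of_disegni h hD hGZK hmod
    mazurTate_sigmaSq_existsUnique_two_holds

/-- **C3′ from T-23008-a BY NAME + three published facts (CONDITIONAL; closes nothing):** `F1Sign2.SchneiderLeadingTermAtTwoSq` + Disegni + GZK +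
modularity ⇒ C3′ (§4 of `…AlignedTransportAtTwoDisegni` with `hMT` discharged). [cite: BalakrishnanMullerStein2015, Thm. 1.7] [cite: Disegni2020, Thm. 1] -/
theorem bsdOfMainConjectureRankOneAtTwo_of_schneiderAtTwoSq_of_disegni (ha : SchneiderLeadingTermAtTwoSq)
    (hD : Disegni2020.padicBSD_goodOrd_rankOne) (hGZK : rank_eq_analyticRank_of_analyticRank_le_one)
    (hmod : nonempty_modularParametrizationData) : BSDOfMainConjectureRankOneAtTwo :=
  AlignedTransportAtTwoDisegni.bsdOfMainConjectureRankOneAtTwo_of_schneiderAtTwo_of_disegni ha hD hGZK hmod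
    mazurTate_sigmaSq_existsUnique_two_holds

/-- **The v2 closure without `hMT` (CONDITIONAL; closes nothing):** T-23008-a + T-23008-b (`PerrinRiouComparisonAtTwo`) + GZK + modularity ⇒ C3′
(`…LeadingTermFinal`, p598696, with `hMT` discharged). [cite: PerrinRiou1987] [cite: Schneider1985, Thm. 2′] -/
theorem bsdOfMainConjectureRankOneAtTwo_of_schneiderAtTwoSq_of_perrinRiouAtTwo (ha : SchneiderLeadingTermAtTwoSq)
    (hb : PerrinRiouComparisonAtTwo) (hGZK : rank_eq_analyticRank_of_analyticRank_le_one)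
    (hmod : nonempty_modularParametrizationData) : BSDOfMainConjectureRankOneAtTwo :=
  AlignedTransportAtTwoLeadingTermFinal.bsdOfMainConjectureRankOneAtTwo_of_schneiderAtTwo_of_perrinRiouAtTwo ha hb hGZK hmod
    mazurTate_sigmaSq_existsUnique_two_holds

/-- **The `lfunction`-route closure without `hMT` (CONDITIONAL; closes nothing):** the cell's K2-Gv (`TwoAdicBSDValRankOneAt`, conjecture-grade at
every `p`) and K2-G′v (`TwoAdicShaAnTransferRankOneAt`) on the C3′ cell + GZK + modularity (`exists_isNewformOf`) + the period unit at `2` ⇒ C3′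
(`…LeadingTermViaTwoAdicBSD`, p597165, with `hMT` discharged; the composition of `Lines/lfunction.lean` minus its `stub_sigmaSqTwo`).
[cite: BalakrishnanMullerStein2015, Conj. 1.4] [cite: PerrinRiou1987] [cite: AbbesUllmo1996, Thm. A] -/
theorem bsdOfMainConjectureRankOneAtTwo_of_twoAdicBSDValAt_of_shaAnTransferAt
    (hGv : ∀ (W : WeierstrassCurve ℚ) [W.IsElliptic] [W.IsGloballyMinimal],
      ¬ W.HasCM → (∀ x : ℚ, ¬ HasRationalTwoTorsionX W x) → ¬ IsSquare W.Δ → TwoAdicBSDValRankOneAt W)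
    (hG'v : ∀ (W : WeierstrassCurve ℚ) [W.IsElliptic] [W.IsGloballyMinimal],
      ¬ W.HasCM → (∀ x : ℚ, ¬ HasRationalTwoTorsionX W x) → ¬ IsSquare W.Δ → TwoAdicShaAnTransferRankOneAt W)
    (hGZK : rank_eq_analyticRank_of_analyticRank_le_one) (hmod : exists_isNewformOf)
    (hper : realPeriodRat_eq_unit_mul_plusPeriod_two) : BSDOfMainConjectureRankOneAtTwo :=
  AlignedTransportAtTwoLeadingTermViaTwoAdicBSD.bsdOfMainConjectureRankOneAtTwo_of_twoAdicBSDValAt_of_shaAnTransferAt hGv hG'v hGZK hmod hper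
    mazurTate_sigmaSq_existsUnique_two_holds

/-! ## §4 Crux level: C3′ IS the open stub restricted to the cell under `MC`, modulo three published facts -/

/-- **C3′ from the open stub ON THE ANALYTIC CELL ONLY (CONDITIONAL on Disegni/GZK/modularity; closes nothing):** it suffices to know
`F1Sign2.SchneiderLeadingTermFormulaAtTwoSqAt W` for the globally minimal `W` that are good ordinary at `2`, of analytic rank one, with a simple zero
of `L₂(f_E)` and `MazurMainConjecture W 2` — the crux's three arithmetic binders (non-CM, no rational `2`-torsion, `Δ ∉ ℚ²`) are idle for this
implication. [cite: Disegni2020, Thm. 1] [cite: BalakrishnanMullerStein2015, Thm. 1.7 (3)] -/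
theorem bsdOfMainConjectureRankOneAtTwo_of_formulaOnOrdinaryRankOne (hD : Disegni2020.padicBSD_goodOrd_rankOne)
    (hGZK : rank_eq_analyticRank_of_analyticRank_le_one) (hmod : nonempty_modularParametrizationData)
    (h : ∀ (W : WeierstrassCurve ℚ) [W.IsElliptic] [W.IsGloballyMinimal], IsOrdinaryAt W 2 → W.analyticRank = 1 →
      (∀ [NeZero (W.conductorNorm ℤ)] (f : CuspForm (Gamma0 (W.conductorNorm ℤ)) 2), IsNewformOf W f →
        (padicLFunction f (unitRoot W 2 : ℚ_[2])).order = 1) →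
      MazurMainConjecture W 2 → SchneiderLeadingTermFormulaAtTwoSqAt W) :
    BSDOfMainConjectureRankOneAtTwo :=
  fun W _ _ _ hord _ _ hr hL hMC =>
    bsdp_of_schneiderLeadingTermFormulaAtTwoSqAt hD hGZK hmod W hord hr hL hMC (h W hord hr hL hMC)

/-- **LOSSLESS AT CRUX LEVEL, BY NAME (CONDITIONAL on Disegni/GZK/modularity; closes nothing):** modulo Disegni 2020 Thm. 1, Gross–Zagier–Kolyvagin and
modularity, the crux `BSDOfMainConjectureRankOneAtTwo` is EQUIVALENT to the registered open stub restricted to the crux's own cell under the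
main-conjecture binder: `∀` globally minimal `W`, non-CM, good ordinary at `2`, no rational `2`-torsion abscissa, `Δ ∉ ℚ²`, `r_an = 1`, simple zero
of `L₂(f_E)`, `MC(W,2)` ⟹ `SchneiderLeadingTermFormulaAtTwoSqAt W`. (⇒: `BSDp W 2` from the crux, then §2's converse; ⇐: §2.) So no cell-wise
input weaker than the Schneider formula at `2` closes C3′, and C3′ proves that formula on its cell.
[cite: Disegni2020, Thm. 1] [cite: BalakrishnanMullerStein2015, Thm. 1.7 (3)] [cite: Schneider1985, Thm. 2′] -/
theorem bsdOfMainConjectureRankOneAtTwo_iff_formulaOnCell (hD : Disegni2020.padicBSD_goodOrd_rankOne)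
    (hGZK : rank_eq_analyticRank_of_analyticRank_le_one) (hmod : nonempty_modularParametrizationData) :
    BSDOfMainConjectureRankOneAtTwo ↔
      ∀ (W : WeierstrassCurve ℚ) [W.IsElliptic] [W.IsGloballyMinimal], ¬ W.HasCM → IsOrdinaryAt W 2 →
        (∀ x : ℚ, ¬ HasRationalTwoTorsionX W x) → ¬ IsSquare W.Δ → W.analyticRank = 1 →
        (∀ [NeZero (W.conductorNorm ℤ)] (f : CuspForm (Gamma0 (W.conductorNorm ℤ)) 2), IsNewformOf W f →
          (padicLFunction f (unitRoot W 2 : ℚ_[2])).order = 1) →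
        MazurMainConjecture W 2 → SchneiderLeadingTermFormulaAtTwoSqAt W :=
  ⟨fun h3 W _ _ hcm hord ht hsq hr hL hMC =>
      schneiderLeadingTermFormulaAtTwoSqAt_of_bsdp hD hGZK hmod W hord hr hL hMC (h3 W hcm hord ht hsq hr hL hMC),
   fun h W _ _ hcm hord ht hsq hr hL hMC =>
      bsdp_of_schneiderLeadingTermFormulaAtTwoSqAt hD hGZK hmod W hord hr hL hMC (h W hcm hord ht hsq hr hL hMC)⟩

end Summit.BirchSwinnertonDyer.BirchSwinnertonDyer.Theorems.AlignedTransportAtTwoSigmaSqTwoDischarge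

end
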